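import Summits.AnomalousDissipation.AnomalousDissipation.Theorems.SolenoidalFractalHomogenisationLadderFunctional
import Mathlib.Analysis.InnerProductSpace.Calculus
import Mathlib.Analysis.Calculus.Deriv.Star
import Mathlib.Analysis.Calculus.Deriv.Prod
import Mathlib.Analysis.Calculus.Deriv.MeanValue
import Mathlib.Analysis.SpecialFunctions.ExpDeriv
import HarnessLib

/-!
# K2R `RealisedQuasiStaticCellLaw`, line `floquet-bloch`, stub `stub_lowSectorDecay` (S1D): ladder functional, decay

Summits-side helper (everything proved; no definitions, no named facts; `--supports stmt-AnomalousDissipation-20446`).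
Companion (file B) of `…Theorems.SolenoidalFractalHomogenisationLadderFunctional` (file A: the pointwise
dissipation inequality `ladderFunctional_deriv_le` and the equivalence `ladderFunctional_equiv` of the frozen
one-parameter functional `Φ(v) = ‖v‖² − 2β Re(conj(v_o)(Sv)_o)`); brick (F2) of the S1D stub plan §3.3
(cell `ad-ideate`, planner ad-p1 gen 15). Here: the scalar Grönwall step.

* `ladderFunctional_decay`: in the abstract setting of file A (finite index type `ι`, complex skew-Hermitian `S`
  with `S o o = 0`, `γ² = Σ_J ‖S_{oJ}‖² ∈ (0,2]`, second ring `Σ_{K≠o} ‖(S²)_{oK}‖² ≤ 4γ²`, real diagonal `d`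
  with `0 ≤ d_o ≤ 1`, `d_J ≥ 1/2` off `o`, `d_J ≤ 2` on the first ring, rate `Λ > 0`, coupling
  `g(s) ∈ [g_lo, g_hi]`, `g_lo > 0`, frozen `β` with `0 < β ≤ g_lo/64`, `βg_hi ≤ 1/64`), every trajectory
  `v ∈ C⁰([a,b]) ∩ C¹((a,b))` of `v' = −Λ(Dv + g(s)Sv)` satisfies
  `Σ‖v_J(s)‖² ≤ (5/3)·exp(−(4/5)Λβγ²g_lo(s−a))·Σ‖v_J(a)‖²` on `[a,b]`;
* `ladderFunctional_decay_explicit`: the same with the admissible choice `β = min(g_lo, g_hi⁻¹)/64`, i.e. energy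
  rate `Λγ²g_lo·min(g_lo, g_hi⁻¹)/80` — `Λγ²g_lo²/80` in the Taylor regime `g_hi ≤ 1`, saturating at
  `Λγ²(g_lo/g_hi)/80` for large couplings.

All constants are independent of `ι` (the Galerkin truncation), which is the point: the S1D far-sector
bookkeeping (§3.5 of the plan) applies it to one good slot per period (`cubatureWord_exists_goodPhase`, file
`…CubatureMoments`) on the half-window where the envelope is `≥ 1/2`, uniformly in the truncation, and passes to
the limit. Deliberately NOT here: the dictionary Bloch block ↦ ladder (the S1D closer's), any `N → ∞` passage.
-/

set_option linter.dupNamespace false -- layout D-0017: `AnomalousDissipation.AnomalousDissipation` repeats by design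

namespace Summit.AnomalousDissipation.AnomalousDissipation.Theorems.SolenoidalFractalHomogenisation.RealisedQuasiStaticCellLaw

noncomputable section

open Set Finset Complex
open scoped BigOperators ComplexConjugate

/-! ## The ODE step: uniform exponential decay -/

/-- **Uniform exponential decay of a ladder block (the brick).** In the abstract setting (module docstring), every
trajectory `v ∈ C⁰([a,b]) ∩ C¹((a,b))` of `v' = −Λ(Dv + g(s)Sv)` with `g(s) ∈ [g_lo, g_hi]` on `(a,b)` and a frozen
`β` with `0 < β ≤ g_lo/64`, `βg_hi ≤ 1/64` satisfies
`Σ_J ‖v_J(s)‖² ≤ (5/3)·exp(−(4/5)Λβg_loγ²·(s − a))·Σ_J ‖v_J(a)‖²` for all `s ∈ [a,b]` — with constants independent of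
the (finite) index type, i.e. of the truncation. Proof: `Φ = ‖v‖² − 2βRe(conj(v_o)(Sv)_o)` has
`Φ' ≤ −Λβg_loγ²‖v‖² ≤ −(4/5)Λβg_loγ²Φ` (`ladderFunctional_deriv_le`, `ladderFunctional_equiv`), so `e^{c(s−a)}Φ` is
non-increasing, and `(3/4)‖v‖² ≤ Φ ≤ (5/4)‖v‖²`. -/
theorem ladderFunctional_decay {ι : Type*} [Fintype ι] [DecidableEq ι] (S : Matrix ι ι ℂ) (d : ι → ℝ) (o : ι)
    (Λ g_lo g_hi β γ2 a b : ℝ) (g : ℝ → ℝ) (v : ℝ → ι → ℂ)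
    (hS : ∀ J K, S K J = -conj (S J K)) (hSo : S o o = 0) (hγ : γ2 = ∑ J, ‖S o J‖ ^ 2)
    (hγpos : 0 < γ2) (hγ2 : γ2 ≤ 2)
    (hρ : ∑ K ∈ univ.erase o, ‖∑ J, S o J * S J K‖ ^ 2 ≤ 4 * γ2)
    (hdo : 0 ≤ d o) (hdo1 : d o ≤ 1) (hd : ∀ J, J ≠ o → 1 / 2 ≤ d J) (hd1 : ∀ J, S o J ≠ 0 → d J ≤ 2)
    (hΛ : 0 < Λ) (hglo : 0 < g_lo) (hg : ∀ s ∈ Ioo a b, g_lo ≤ g s ∧ g s ≤ g_hi)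
    (hβ : 0 < β) (hβ1 : β ≤ g_lo / 64) (hβ2 : β * g_hi ≤ 1 / 64)
    (hcont : ContinuousOn v (Icc a b))
    (hderiv : ∀ s ∈ Ioo a b, HasDerivAt v
        (fun J => -(Λ : ℂ) * ((d J : ℂ) * v s J + (g s : ℂ) * ∑ K, S J K * v s K)) s) :
    ∀ s ∈ Icc a b, ∑ J, ‖v s J‖ ^ 2 ≤
      5 / 3 * Real.exp (-(4 / 5 * (Λ * β * g_lo * γ2)) * (s - a)) * ∑ J, ‖v a J‖ ^ 2 := by
  intro s hs
  rcases le_or_gt b a with hba | hab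
  · -- degenerate interval: `s = a`
    have hsa : s = a := le_antisymm (le_trans hs.2 hba) hs.1
    subst hsa
    have hE0 : 0 ≤ ∑ J, ‖v s J‖ ^ 2 := Finset.sum_nonneg fun J _ => by positivity
    rw [sub_self, mul_zero, Real.exp_zero, mul_one]
    linarith
  -- `β ≤ 1/64` (uses one interior point to compare `g_lo ≤ g_hi`)
  have hgg : g_lo ≤ g_hi := by
    obtain ⟨h1, h2⟩ := hg ((a + b) / 2) ⟨by linarith, by linarith⟩
    exact h1.trans h2
  have hβ64 : β ≤ 1 / 64 := by
    have h1 : β * g_lo ≤ 1 / 64 := (mul_le_mul_of_nonneg_left hgg hβ.le).trans hβ2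
    by_cases hg1 : g_lo ≤ 1
    · linarith
    · have : β * 1 ≤ β * g_lo := mul_le_mul_of_nonneg_left (not_le.mp hg1).le hβ.le
      linarith
  -- the field, the energy, the functional
  set F : ℝ → ι → ℂ := fun t J => -(Λ : ℂ) * ((d J : ℂ) * v t J + (g t : ℂ) * ∑ K, S J K * v t K) with hFdef
  set E : ℝ → ℝ := fun t => ∑ J, ‖v t J‖ ^ 2 with hEdef
  set ψ : ℝ → ℝ := fun t => (conj (v t o) * ∑ J, S o J * v t J).re with hψdef
  set φ : ℝ → ℝ := fun t => E t - 2 * β * ψ t with hφdef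
  set c : ℝ := 4 / 5 * (Λ * β * g_lo * γ2) with hcdef
  have hc0 : 0 ≤ c := by positivity
  -- equivalence `(3/4)E ≤ φ ≤ (5/4)E` at every time
  have hequiv : ∀ t, 3 / 4 * E t ≤ φ t ∧ φ t ≤ 5 / 4 * E t := by
    intro t
    have h := ladderFunctional_equiv S o β γ2 (v t) hSo hγ hγ2 hβ.le hβ64
    rw [abs_le] at h
    simp only [hφdef, hEdef, hψdef]
    constructor <;> linarith [h.1, h.2]
  -- derivative of φ in the interior and its sign
  have hφ' : ∀ t ∈ Ioo a b, ∃ D : ℝ, HasDerivAt φ D t ∧ D ≤ -c * φ t := by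
    intro t ht
    have hv : ∀ J, HasDerivAt (fun t => v t J) (F t J) t := fun J => (hasDerivAt_pi.1 (hderiv t ht)) J
    -- energy
    have hE' : HasDerivAt E (∑ J, 2 * (conj (v t J) * F t J).re) t := by
      have : ∀ J ∈ (univ : Finset ι), HasDerivAt (fun t => ‖v t J‖ ^ 2) (2 * (conj (v t J) * F t J).re) t := by
        intro J _
        have h := (hv J).norm_sq
        simp only [Complex.inner, mul_comm (F t J)] at h
        exact h
      simpa [hEdef] using HasDerivAt.fun_sum this
    -- the cross term
    have hconj : HasDerivAt (fun t => conj (v t o)) (conj (F t o)) t := (hv o).star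
    have hrowv : HasDerivAt (fun t => ∑ J, S o J * v t J) (∑ J, S o J * F t J) t :=
      HasDerivAt.fun_sum fun J _ => (hv J).const_mul (S o J)
    have hprod := hconj.mul hrowv
    have hψ' : HasDerivAt ψ ((conj (F t o) * ∑ J, S o J * v t J).re +
        (conj (v t o) * ∑ J, S o J * F t J).re) t := by
      have h := (Complex.reCLM.hasFDerivAt.comp_hasDerivAt t hprod)
      simp only [Complex.reCLM_apply, Complex.add_re] at h
      simpa [hψdef, Function.comp_def] using h
    have hφt : HasDerivAt φ ((∑ J, 2 * (conj (v t J) * F t J).re) -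
        2 * β * ((conj (F t o) * ∑ J, S o J * v t J).re + (conj (v t o) * ∑ J, S o J * F t J).re)) t := by
      exact hE'.fun_sub (hψ'.const_mul (2 * β))
    refine ⟨_, hφt, ?_⟩
    obtain ⟨hg1, hg2⟩ := hg t ht
    have hcore := ladderFunctional_deriv_le S d o Λ g_lo g_hi (g t) β γ2 (v t) (F t) hS hSo hγ hγpos hγ2 hρ
      hdo hdo1 hd hd1 hΛ hglo hg1 hg2 hβ hβ1 hβ2 (fun J => rfl)
    have h54 := (hequiv t).2
    have hpos : 0 ≤ Λ * β * g_lo * γ2 := by positivity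
    have : -(Λ * β * g_lo * γ2) * E t ≤ -c * φ t := by
      rw [hcdef]
      nlinarith
    exact hcore.trans this
  -- `h(t) = exp(c (t − a)) φ(t)` is non-increasing on `[a,b]`
  set h : ℝ → ℝ := fun t => Real.exp (c * (t - a)) * φ t with hhdef
  have hcontφ : ContinuousOn φ (Icc a b) := by
    have hvJ : ∀ J, ContinuousOn (fun t => v t J) (Icc a b) := fun J => continuousOn_pi.1 hcont J
    have hE : ContinuousOn E (Icc a b) := by
      simp only [hEdef]
      exact continuousOn_finsetSum _ fun J _ => ((hvJ J).norm).pow 2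
    have hψc : ContinuousOn ψ (Icc a b) := by
      simp only [hψdef]
      refine Complex.continuous_re.comp_continuousOn ?_
      refine ContinuousOn.mul (Complex.continuous_conj.comp_continuousOn (hvJ o)) ?_
      exact continuousOn_finsetSum _ fun J _ => (hvJ J).const_smul (S o J) |>.congr (fun t _ => by simp)
    simp only [hφdef]
    exact hE.sub (hψc.const_smul (2 * β) |>.congr (fun t _ => by simp [smul_eq_mul]))
  have hconth : ContinuousOn h (Icc a b) := by
    simp only [hhdef]
    exact ((Real.continuous_exp.comp (continuous_const.mul (continuous_id.sub continuous_const))).continuousOn).mul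
      hcontφ
  have hexp : ∀ t, HasDerivAt (fun t => Real.exp (c * (t - a))) (Real.exp (c * (t - a)) * c) t := by
    intro t
    have := (((hasDerivAt_id t).sub_const a).const_mul c).exp
    simpa using this
  have hh' : ∀ t ∈ Ioo a b, ∃ D : ℝ, HasDerivAt h D t ∧ D ≤ 0 := by
    intro t ht
    obtain ⟨D, hD, hDle⟩ := hφ' t ht
    refine ⟨Real.exp (c * (t - a)) * c * φ t + Real.exp (c * (t - a)) * D, (hexp t).mul hD, ?_⟩
    have hpos : 0 < Real.exp (c * (t - a)) := Real.exp_pos _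
    have : Real.exp (c * (t - a)) * c * φ t + Real.exp (c * (t - a)) * D =
        Real.exp (c * (t - a)) * (c * φ t + D) := by ring
    rw [this]
    exact mul_nonpos_of_nonneg_of_nonpos hpos.le (by linarith)
  have hanti : AntitoneOn h (Icc a b) := by
    refine antitoneOn_of_deriv_nonpos (convex_Icc a b) hconth ?_ ?_
    · rw [interior_Icc]
      intro t ht
      obtain ⟨D, hD, -⟩ := hh' t ht
      exact hD.differentiableAt.differentiableWithinAt
    · rw [interior_Icc]
      intro t ht
      obtain ⟨D, hD, hDle⟩ := hh' t ht
      rw [hD.deriv]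
      exact hDle
  have hmono := hanti (left_mem_Icc.2 hab.le) hs hs.1
  -- unwind
  have hha : h a = φ a := by simp [hhdef]
  rw [hha] at hmono
  have hexp_pos : 0 < Real.exp (c * (s - a)) := Real.exp_pos _
  have h1 : φ s ≤ Real.exp (-c * (s - a)) * φ a := by
    have : Real.exp (-c * (s - a)) * (Real.exp (c * (s - a)) * φ s) ≤ Real.exp (-c * (s - a)) * φ a :=
      mul_le_mul_of_nonneg_left hmono (Real.exp_pos _).le
    rwa [← mul_assoc, ← Real.exp_add, show -c * (s - a) + c * (s - a) = 0 by ring, Real.exp_zero,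
      one_mul] at this
  have h2 := (hequiv s).1
  have h3 := (hequiv a).2
  have hEa : 0 ≤ E a := Finset.sum_nonneg fun J _ => by positivity
  have h4 : Real.exp (-c * (s - a)) * φ a ≤ Real.exp (-c * (s - a)) * (5 / 4 * E a) :=
    mul_le_mul_of_nonneg_left h3 (Real.exp_pos _).le
  show E s ≤ 5 / 3 * Real.exp (-c * (s - a)) * E a
  nlinarith [Real.exp_pos (-c * (s - a))]

/-- **The brick with the explicit frozen parameter** `β = min(g_lo, g_hi⁻¹)/64` (admissible whenever
`0 < g_lo ≤ g_hi`): energy decay `‖v(s)‖² ≤ (5/3)·exp(−Λγ²g_lo·min(g_lo, g_hi⁻¹)·(s−a)/80)·‖v(a)‖²` on `[a,b]`,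
uniformly in the truncation. In the Taylor regime (`g_hi ≤ 1`) the certified energy rate is `Λγ²g_lo²/80`; for large
couplings it saturates at `Λγ²(g_lo/g_hi)/80` — any explicit positive floor serves the far-sector bookkeeping of S1D. -/
theorem ladderFunctional_decay_explicit {ι : Type*} [Fintype ι] [DecidableEq ι] (S : Matrix ι ι ℂ) (d : ι → ℝ)
    (o : ι) (Λ g_lo g_hi γ2 a b : ℝ) (g : ℝ → ℝ) (v : ℝ → ι → ℂ)
    (hS : ∀ J K, S K J = -conj (S J K)) (hSo : S o o = 0) (hγ : γ2 = ∑ J, ‖S o J‖ ^ 2)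
    (hγpos : 0 < γ2) (hγ2 : γ2 ≤ 2)
    (hρ : ∑ K ∈ univ.erase o, ‖∑ J, S o J * S J K‖ ^ 2 ≤ 4 * γ2)
    (hdo : 0 ≤ d o) (hdo1 : d o ≤ 1) (hd : ∀ J, J ≠ o → 1 / 2 ≤ d J) (hd1 : ∀ J, S o J ≠ 0 → d J ≤ 2)
    (hΛ : 0 < Λ) (hglo : 0 < g_lo) (hghi : g_lo ≤ g_hi) (hg : ∀ s ∈ Ioo a b, g_lo ≤ g s ∧ g s ≤ g_hi)
    (hcont : ContinuousOn v (Icc a b))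
    (hderiv : ∀ s ∈ Ioo a b, HasDerivAt v
        (fun J => -(Λ : ℂ) * ((d J : ℂ) * v s J + (g s : ℂ) * ∑ K, S J K * v s K)) s) :
    ∀ s ∈ Icc a b, ∑ J, ‖v s J‖ ^ 2 ≤
      5 / 3 * Real.exp (-(Λ * γ2 * g_lo * min g_lo g_hi⁻¹ / 80) * (s - a)) * ∑ J, ‖v a J‖ ^ 2 := by
  have hghi0 : 0 < g_hi := lt_of_lt_of_le hglo hghi
  set β : ℝ := min g_lo g_hi⁻¹ / 64 with hβdef
  have hβ : 0 < β := by
    rw [hβdef]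
    exact div_pos (lt_min hglo (inv_pos.mpr hghi0)) (by norm_num)
  have hβ1 : β ≤ g_lo / 64 := by
    rw [hβdef]
    exact div_le_div_of_nonneg_right (min_le_left _ _) (by norm_num)
  have hβ2 : β * g_hi ≤ 1 / 64 := by
    rw [hβdef]
    have : min g_lo g_hi⁻¹ * g_hi ≤ g_hi⁻¹ * g_hi := mul_le_mul_of_nonneg_right (min_le_right _ _) hghi0.le
    rw [inv_mul_cancel₀ hghi0.ne'] at this
    calc min g_lo g_hi⁻¹ / 64 * g_hi = min g_lo g_hi⁻¹ * g_hi / 64 := by ring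
      _ ≤ 1 / 64 := by linarith
  intro s hs
  have h := ladderFunctional_decay S d o Λ g_lo g_hi β γ2 a b g v hS hSo hγ hγpos hγ2 hρ hdo hdo1 hd hd1 hΛ hglo hg
    hβ hβ1 hβ2 hcont hderiv s hs
  have e : -(4 / 5 * (Λ * β * g_lo * γ2)) = -(Λ * γ2 * g_lo * min g_lo g_hi⁻¹ / 80) := by
    rw [hβdef]; ring
  rwa [e] at h

end

end Summit.AnomalousDissipation.AnomalousDissipation.Theorems.SolenoidalFractalHomogenisation.RealisedQuasiStaticCellLaw
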